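import Summits.PneNP.PneNP.Theorems.ChebyshevTracialDesignPureStateReduction
import Summits.PneNP.PneNP.Theorems.ChebyshevTracialDesignBoundedDimension
import HarnessLib

/-!
# Cell pnp-psdrank, route `ChebyshevTracialDesign`: NOWHERE-ZERO PADDING — the activity pattern is free in the dimension budget: the crux
# `TracialDecayExp20` restricted to strategies WITHOUT ZERO OPERATORS already implies `TracialDecayExp20` (crux stmt-PneNP-19878)

Brick 80 (prover g14). Bricks 76/79 prove that at dimension `r = 3` a tight-orthogonal psd rectangle with NO ZERO OPERATOR (every `X_U ≠ 0`,
every `Y_M ≠ 0`, so that EVERY tight pair is a genuine orthogonality constraint) is worth one tight rectangle, and locate the difficulty of the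
dense cell at `r = 3` in the ACTIVITY PATTERN. This file shows that the restriction 'no zero operator' is VACUOUS in the crux's dimension budget:
* §2 THE SLACK STRATEGY (`exists_slackStrategy`): the Gram vectors of the slack matrix itself, `p_U = (1[e ∈ δ(U)])_e ⊕ (−1)`,
  `q_M = (1[e ∈ M])_e ⊕ 1` on `Sym2(Fin n) ⊕ pt`, have `⟨p_U, q_M⟩ = |δ(U) ∩ M| − 1` (`slack_pairing`), so the normalised projections
  `P_U = p̂_U p̂_Uᵀ`, `Q_M = q̂_M q̂_Mᵀ` form a tight-orthogonal psd rectangle of dimension `m₀ = C(n+1,2) + 1 ≤ 2(dq n + 1)⁸` with no zero operator;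
* §1 PADDING (`isPsdRect_pad`, `trace_pad_mul_pad`): block-diagonal sums of tight-orthogonal psd rectangles, re-indexed to `Fin (r + m)`, are
  tight-orthogonal psd rectangles whose value kernel is the sum of the kernels; `(X ⊕ εP, Y ⊕ Q)` has no zero operator for `ε > 0` (`exists_padded`);
* §4 **`tracialDecayExp20_of_nowhereZero`**: if the body of `TracialDecayExp20` holds with constant `a` for all tight-orthogonal psd rectangles
  without zero operators, then it holds with constant `a/2` for ALL of them — pad `(X, Y)` of dimension `r` (`r²n < exp(aD/2)`) to dimension
  `R = r + m₀ ≤ exp(aD/2)` (budget `R²n < exp(aD)` for large `n`, §3), read off `Σ W tr(XY) + ε·s ≤ R·exp(−aD)` for every `ε ∈ (0,1]`, let `ε → 0`.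
CONSEQUENCE FOR THE PROGRAMME (MEMO-17): 'exact / fully active' is a simplification ONLY in low dimension; in the budget regime (`r` up to
`exp(a·dq n/2)/√n ≫ n²`) every tight psd rectangle is, up to an `ε`-perturbation of the value and `+ m₀` in the dimension, a nowhere-zero one. So the
exact theorems of bricks 76/79 cannot be 'robustified then lifted in `r`' without meeting the full crux: an exact theorem at dimension `≥ C(n+1,2)+4`
IS the crux (with `a ↦ a/2`). The conclusion of §4 is token-for-token the body of the route decl `TracialDecayExp20` (the route file is not importable
from a support file, D-0016 build rule), the hypothesis is the same body with the two extra binders `(∀ U, X U ≠ 0) (∀ M, Y M ≠ 0)`.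
[cite: Rothvoss2017, §2 (PDF pp. 5–6: `δ(U)`, `|δ(U) ∩ M|`, the slack `|δ(U) ∩ M| − 1`)] [cite: BrietDadushPokutta2014, Thm. 6 (§3)]
Stature: support/instrument (a reduction between two forms of the OPEN crux; elementary block-matrix algebra + asymptotic bookkeeping).
WHAT THIS IS NOT: no bound on any value, nothing on psd rank of P_PM(K_n), no P-vs-NP content.
-/

set_option linter.dupNamespace false -- `Summit.PneNP.PneNP.…`: summit = sub-problem (D-0017)

noncomputable section

namespace Summit.PneNP.PneNP.Theorems.ChebyshevTracialDesignNowhereZeroPadding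

open Finset Matrix Literature.Barriers.PneNP Literature.Combinatorics.Optimization
open Literature.Combinatorics.SimpleGraph.CycleSpace
open Summit.PneNP.PneNP.Theorems.ChebyshevTracialDesignPureStateReduction
open Summit.PneNP.PneNP.Theorems.ChebyshevTracialDesignBoundedDim (le_dq_of_pow_le)

/-! ### §1 Block-diagonal padding and re-indexing -/

section Padding

variable {l m σ τ : Type*}

/-- A block-diagonal matrix with psd blocks is psd. -/
theorem posSemidef_fromBlocks_diag [Fintype l] [Fintype m] {A : Matrix l l ℝ} {D : Matrix m m ℝ} (hA : A.PosSemidef)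
    (hD : D.PosSemidef) :
    (fromBlocks A 0 0 D).PosSemidef := by
  refine PosSemidef.of_dotProduct_mulVec_nonneg (IsHermitian.fromBlocks hA.1 (by simp) hD.1) fun x => ?_
  have h1 := hA.dotProduct_mulVec_nonneg (x ∘ Sum.inl)
  have h2 := hD.dotProduct_mulVec_nonneg (x ∘ Sum.inr)
  rw [star_trivial] at h1 h2 ⊢
  have h : x ⬝ᵥ fromBlocks A 0 0 D *ᵥ x = (x ∘ Sum.inl) ⬝ᵥ A *ᵥ (x ∘ Sum.inl) + (x ∘ Sum.inr) ⬝ᵥ D *ᵥ (x ∘ Sum.inr) := by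
    rw [fromBlocks_mulVec, zero_mulVec, zero_mulVec, add_zero, zero_add]
    simp only [dotProduct, Fintype.sum_sum_type, Sum.elim_inl, Sum.elim_inr, Function.comp_apply]
  rw [h]
  exact add_nonneg h1 h2

/-- `1 − (A ⊕ D) = (1 − A) ⊕ (1 − D)`. -/
theorem one_sub_fromBlocks_diag [DecidableEq l] [DecidableEq m] (A : Matrix l l ℝ) (D : Matrix m m ℝ) :
    1 - fromBlocks A 0 0 D = fromBlocks (1 - A) 0 0 (1 - D) := by
  rw [← fromBlocks_one, sub_eq_add_neg, fromBlocks_neg, fromBlocks_add]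
  simp [sub_eq_add_neg]

/-- Products of block-diagonal matrices. -/
theorem fromBlocks_diag_mul [Fintype l] [Fintype m] (A A' : Matrix l l ℝ) (D D' : Matrix m m ℝ) :
    fromBlocks A 0 0 D * fromBlocks A' 0 0 D' = fromBlocks (A * A') 0 0 (D * D') := by
  rw [fromBlocks_multiply]; simp

/-- The trace of a block matrix is the sum of the traces of the diagonal blocks. -/
theorem trace_fromBlocks' [Fintype l] [Fintype m] (A : Matrix l l ℝ) (B : Matrix l m ℝ) (C : Matrix m l ℝ) (D : Matrix m m ℝ) :
    (fromBlocks A B C D).trace = A.trace + D.trace := by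
  simp [Matrix.trace, Fintype.sum_sum_type]

/-- A block-diagonal matrix with a nonzero block is nonzero. -/
theorem fromBlocks_diag_ne_zero {A : Matrix l l ℝ} {D : Matrix m m ℝ} (hD : D ≠ 0) : fromBlocks A 0 0 D ≠ 0 := by
  intro h; rw [← fromBlocks_zero, fromBlocks_inj] at h; exact hD h.2.2.2

/-- Re-indexing by an equivalence preserves the trace. -/
theorem trace_submatrix_equiv [Fintype σ] [Fintype τ] (A : Matrix σ σ ℝ) (f : τ ≃ σ) : (A.submatrix f f).trace = A.trace := by
  simp only [Matrix.trace, Matrix.diag, submatrix_apply]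
  exact f.sum_comp (fun i => A i i)

/-- Re-indexing by an equivalence preserves being nonzero. -/
theorem submatrix_equiv_ne_zero {A : Matrix σ σ ℝ} (f : τ ≃ σ) (hA : A ≠ 0) : A.submatrix f f ≠ 0 := by
  intro h; apply hA
  have h2 := congrArg (fun B : Matrix τ τ ℝ => B.submatrix f.symm f.symm) h
  simp only [submatrix_submatrix, Equiv.self_comp_symm, submatrix_id_id, submatrix_zero, Pi.zero_apply] at h2
  exact h2

/-- `1 − A∘f = (1 − A)∘f` for an equivalence `f`. -/
theorem one_sub_submatrix_equiv [DecidableEq σ] [DecidableEq τ] (A : Matrix σ σ ℝ) (f : τ ≃ σ) :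
    1 - A.submatrix f f = (1 - A).submatrix f f := by
  simp only [submatrix_sub, Pi.sub_apply, submatrix_one_equiv]

end Padding

section PadRect

variable {n r m R : ℕ}

/-- **Padding psd rectangles.** The block-diagonal sum of two tight-orthogonal psd rectangles (dimensions `r` and `m`), re-indexed to `Fin R` along
`e : Fin R ≃ Fin r ⊕ Fin m`, is a tight-orthogonal psd rectangle of dimension `R`. [cite: BrietDadushPokutta2014, Thm. 6 (§3)] -/
theorem isPsdRect_pad (e : Fin R ≃ Fin r ⊕ Fin m) {X : OddSet n → Matrix (Fin r) (Fin r) ℝ} {Y : PMatch n → Matrix (Fin r) (Fin r) ℝ}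
    {X' : OddSet n → Matrix (Fin m) (Fin m) ℝ} {Y' : PMatch n → Matrix (Fin m) (Fin m) ℝ} (hXY : IsPsdRect X Y) (hXY' : IsPsdRect X' Y') :
    IsPsdRect (fun U => (fromBlocks (X U) 0 0 (X' U)).submatrix e e) (fun M => (fromBlocks (Y M) 0 0 (Y' M)).submatrix e e) := by
  refine ⟨fun U => ⟨?_, ?_⟩, fun M => ⟨?_, ?_⟩, fun U M h => ?_⟩
  · exact (posSemidef_submatrix_equiv e).2 (posSemidef_fromBlocks_diag (hXY.1 U).1 (hXY'.1 U).1)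
  · rw [one_sub_submatrix_equiv, one_sub_fromBlocks_diag]
    exact (posSemidef_submatrix_equiv e).2 (posSemidef_fromBlocks_diag (hXY.1 U).2 (hXY'.1 U).2)
  · exact (posSemidef_submatrix_equiv e).2 (posSemidef_fromBlocks_diag (hXY.2.1 M).1 (hXY'.2.1 M).1)
  · rw [one_sub_submatrix_equiv, one_sub_fromBlocks_diag]
    exact (posSemidef_submatrix_equiv e).2 (posSemidef_fromBlocks_diag (hXY.2.1 M).2 (hXY'.2.1 M).2)
  · show (fromBlocks (X U) 0 0 (X' U)).submatrix e e * (fromBlocks (Y M) 0 0 (Y' M)).submatrix e e = 0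
    rw [submatrix_mul_equiv, fromBlocks_diag_mul, hXY.2.2 U M h, hXY'.2.2 U M h, fromBlocks_zero, submatrix_zero, Pi.zero_apply,
      Pi.zero_apply]

/-- The value kernel of a padded pair is the sum of the kernels. -/
theorem trace_pad_mul_pad (e : Fin R ≃ Fin r ⊕ Fin m) (A B : Matrix (Fin r) (Fin r) ℝ) (A' B' : Matrix (Fin m) (Fin m) ℝ) :
    ((fromBlocks A 0 0 A').submatrix e e * (fromBlocks B 0 0 B').submatrix e e).trace = (A * B).trace + (A' * B').trace := by
  rw [submatrix_mul_equiv, fromBlocks_diag_mul, trace_submatrix_equiv, trace_fromBlocks']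

/-- Scaling the cut side by `ε ∈ [0,1]` keeps a tight-orthogonal psd rectangle. -/
theorem isPsdRect_smul {X : OddSet n → Matrix (Fin m) (Fin m) ℝ} {Y : PMatch n → Matrix (Fin m) (Fin m) ℝ} (hXY : IsPsdRect X Y)
    {ε : ℝ} (hε0 : 0 ≤ ε) (hε1 : ε ≤ 1) : IsPsdRect (fun U => ε • X U) Y := by
  refine ⟨fun U => ⟨(hXY.1 U).1.smul hε0, ?_⟩, hXY.2.1, fun U M h => ?_⟩
  · have h : 1 - ε • X U = (1 - X U) + (1 - ε) • X U := by rw [sub_smul, one_smul]; abel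
    rw [h]
    exact (hXY.1 U).2.add ((hXY.1 U).1.smul (by linarith))
  · show ε • X U * Y M = 0
    rw [smul_mul_assoc, hXY.2.2 U M h, smul_zero]

end PadRect

/-! ### §2 The slack strategy: an exact nowhere-zero tight psd rectangle of dimension `C(n+1,2) + 1` -/

section Slack

variable {n : ℕ}

/-- Normalising a nonzero real vector. -/
theorem exists_unit_smul' {ι : Type*} [Fintype ι] {v : ι → ℝ} (hv : 0 < v ⬝ᵥ v) : ∃ c : ℝ, (c • v) ⬝ᵥ (c • v) = 1 := by
  refine ⟨(Real.sqrt (v ⬝ᵥ v))⁻¹, ?_⟩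
  rw [smul_dotProduct, dotProduct_smul, smul_eq_mul, smul_eq_mul, ← mul_assoc, ← mul_inv, Real.mul_self_sqrt hv.le,
    inv_mul_cancel₀ hv.ne']

/-- **The slack pairing.** With `p_U = (1[e crosses U])_e ⊕ (−1)` and `q_M = (1[e ∈ M])_e ⊕ 1` on `Sym2(Fin n) ⊕ pt`:
`⟨p_U, q_M⟩ = |δ(U) ∩ M| − 1 = cc(U,M) − 1` — the slack matrix of the perfect matching polytope as a Gram matrix.
[cite: Rothvoss2017, §2 (PDF pp. 5–6: `δ(U)`, `|δ(U) ∩ M|`, the slack `|δ(U) ∩ M| − 1`)] -/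
theorem slack_pairing (U : OddSet n) (M : PMatch n) :
    (fun o : Option (Sym2 (Fin n)) => o.elim (-1 : ℝ) fun e => if Crosses U.1 e then 1 else 0) ⬝ᵥ
      (fun o : Option (Sym2 (Fin n)) => o.elim (1 : ℝ) fun e => if e ∈ M.1 then 1 else 0) = (cc U M : ℝ) - 1 := by
  simp only [dotProduct, Fintype.sum_option, Option.elim_none, Option.elim_some, ite_zero_mul_ite_zero, mul_one]
  rw [sum_boole, cc]
  have h : (univ.filter fun e : Sym2 (Fin n) => Crosses U.1 e ∧ e ∈ M.1) = M.1.filter (Crosses U.1) := by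
    ext e; simp only [mem_filter, mem_univ, true_and]; tauto
  rw [h]; ring

/-- **THE SLACK STRATEGY.** For every `n` there is a tight-orthogonal psd rectangle `(P, Q)` of dimension `m₀ = |Sym2(Fin n)| + 1` on `K_n` with NO ZERO
OPERATOR: `P_U = p̂_U p̂_Uᵀ`, `Q_M = q̂_M q̂_Mᵀ` for the normalised slack vectors, orthogonal EXACTLY on the tight pairs (`⟨p_U, q_M⟩ = cc(U,M) − 1`).
[cite: Rothvoss2017, §2 (PDF pp. 5–6)] [cite: BrietDadushPokutta2014, Thm. 6 (§3)] -/
theorem exists_slackStrategy (n : ℕ) :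
    ∃ (P : OddSet n → Matrix (Fin (Fintype.card (Option (Sym2 (Fin n))))) (Fin (Fintype.card (Option (Sym2 (Fin n))))) ℝ)
      (Q : PMatch n → Matrix (Fin (Fintype.card (Option (Sym2 (Fin n))))) (Fin (Fintype.card (Option (Sym2 (Fin n))))) ℝ),
      IsPsdRect P Q ∧ (∀ U, P U ≠ 0) ∧ ∀ M, Q M ≠ 0 := by
  classical
  set f := (Fintype.equivFin (Option (Sym2 (Fin n)))).symm with hf
  set p : OddSet n → Option (Sym2 (Fin n)) → ℝ := fun U o => o.elim (-1 : ℝ) fun e => if Crosses U.1 e then 1 else 0 with hp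
  set q : PMatch n → Option (Sym2 (Fin n)) → ℝ := fun M o => o.elim (1 : ℝ) fun e => if e ∈ M.1 then 1 else 0 with hq
  -- transport to `Fin m₀` and normalise
  have hpf : ∀ U M, (p U ∘ f) ⬝ᵥ (q M ∘ f) = (cc U M : ℝ) - 1 := fun U M => by
    rw [← slack_pairing U M]
    exact f.sum_comp (fun o => p U o * q M o)
  have hpos : ∀ (v : Option (Sym2 (Fin n)) → ℝ), v none ^ 2 = 1 → 0 < (v ∘ f) ⬝ᵥ (v ∘ f) := fun v hv => by
    have h : (v ∘ f) ⬝ᵥ (v ∘ f) = ∑ o, v o * v o := f.sum_comp (fun o => v o * v o)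
    rw [h, Fintype.sum_option]
    have h2 : 0 ≤ ∑ e : Sym2 (Fin n), v (some e) * v (some e) := sum_nonneg fun e _ => mul_self_nonneg _
    nlinarith
  have hcp : ∀ U, ∃ c : ℝ, (c • (p U ∘ f)) ⬝ᵥ (c • (p U ∘ f)) = 1 := fun U => exists_unit_smul' (hpos (p U) (by simp [hp]))
  have hcq : ∀ M, ∃ d : ℝ, (d • (q M ∘ f)) ⬝ᵥ (d • (q M ∘ f)) = 1 := fun M => exists_unit_smul' (hpos (q M) (by simp [hq]))
  choose c hc using hcp
  choose d hd using hcq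
  refine ⟨fun U => vecMulVec (c U • (p U ∘ f)) (c U • (p U ∘ f)), fun M => vecMulVec (d M • (q M ∘ f)) (d M • (q M ∘ f)),
    isPsdRect_vecMulVec _ _ (fun U => (hc U).le) (fun M => (hd M).le) fun U M h => ?_, fun U => ?_, fun M => ?_⟩
  · rw [smul_dotProduct, dotProduct_smul, hpf U M, h]; simp
  · rw [Ne, vecMulVec_eq_zero, or_self]
    intro h0; have h1 := hc U; rw [h0, dotProduct_zero] at h1; exact zero_ne_one h1
  · rw [Ne, vecMulVec_eq_zero, or_self]
    intro h0; have h1 := hd M; rw [h0, dotProduct_zero] at h1; exact zero_ne_one h1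

end Slack

/-! ### §3 Asymptotic bookkeeping -/

section Asymptotics

/-- Polynomial growth is eventually dominated by an exponential: `C·(D+1)^k ≤ exp(b·D)` for all `D ≥ D₀`. -/
theorem exists_mul_pow_le_exp {b C : ℝ} (hb : 0 < b) (hC : 0 < C) (k : ℕ) :
    ∃ D₀ : ℕ, ∀ D : ℕ, D₀ ≤ D → C * ((D : ℝ) + 1) ^ k ≤ Real.exp (b * D) := by
  have h := (isLittleO_pow_exp_pos_mul_atTop k hb).def (show (0 : ℝ) < Real.exp (-b) / C by positivity)
  rw [Filter.eventually_atTop] at h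
  obtain ⟨x₀, hx₀⟩ := h
  obtain ⟨D₀, hD₀⟩ := exists_nat_ge x₀
  refine ⟨D₀, fun D hD => ?_⟩
  have hx : x₀ ≤ (D : ℝ) + 1 := by
    have : (D₀ : ℝ) ≤ D := by exact_mod_cast hD
    linarith
  have h1 := hx₀ _ hx
  rw [Real.norm_of_nonneg (by positivity), Real.norm_of_nonneg (Real.exp_pos _).le, div_mul_eq_mul_div, le_div_iff₀ hC,
    ← Real.exp_add, show -b + b * ((D : ℝ) + 1) = b * D by ring] at h1
  linarith

/-- `n + 1 ≤ (dq n + 1)⁴` over `ℝ` (the tree's `lt_dq_succ_pow_four` lives in a module importing the route file, which a support file must not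
import — re-derived from `Nat.lt_succ_sqrt'` twice). [cite: CoppersmithRivlin1992, Thm. (p. 970); elementary] -/
theorem natCast_succ_le_dq_succ_pow_four (n : ℕ) : (n : ℝ) + 1 ≤ ((dq n : ℝ) + 1) ^ 4 := by
  have h1 : n < (Nat.sqrt n + 1) ^ 2 := by
    have := Nat.lt_succ_sqrt' n; simpa [sq] using this
  have h2 : Nat.sqrt n < (dq n + 1) ^ 2 := by
    have := Nat.lt_succ_sqrt' (Nat.sqrt n); rw [dq]; simpa [sq] using this
  have h3 : Nat.sqrt n + 1 ≤ (dq n + 1) ^ 2 := h2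
  have h4 : n + 1 ≤ (dq n + 1) ^ 4 :=
    calc n + 1 ≤ (Nat.sqrt n + 1) ^ 2 := h1
      _ ≤ ((dq n + 1) ^ 2) ^ 2 := Nat.pow_le_pow_left h3 2
      _ = (dq n + 1) ^ 4 := by ring
  exact_mod_cast h4

/-- The padding dimension: `|Option (Sym2 (Fin n))| = C(n+1, 2) + 1 ≤ 2·(dq n + 1)⁸`. -/
theorem card_option_sym2_le (n : ℕ) : (Fintype.card (Option (Sym2 (Fin n))) : ℝ) ≤ 2 * ((dq n : ℝ) + 1) ^ 8 := by
  have h1 : Fintype.card (Option (Sym2 (Fin n))) = (n + 1).choose 2 + 1 := by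
    rw [Fintype.card_option, Sym2.card, Fintype.card_fin]
  have h2 : (n + 1).choose 2 ≤ (n + 1) ^ 2 := Nat.choose_le_pow _ _
  have h3 : n + 1 ≤ (dq n + 1) ^ 4 := by exact_mod_cast natCast_succ_le_dq_succ_pow_four n
  have h4 : (n + 1) ^ 2 ≤ ((dq n + 1) ^ 4) ^ 2 := Nat.pow_le_pow_left h3 2
  have h5 : Fintype.card (Option (Sym2 (Fin n))) ≤ 2 * (dq n + 1) ^ 8 := by
    rw [h1]
    have : 1 ≤ (dq n + 1) ^ 8 := Nat.one_le_pow _ _ (by omega)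
    calc (n + 1).choose 2 + 1 ≤ (n + 1) ^ 2 + (dq n + 1) ^ 8 := Nat.add_le_add h2 this
      _ ≤ ((dq n + 1) ^ 4) ^ 2 + (dq n + 1) ^ 8 := Nat.add_le_add_right h4 _
      _ = 2 * (dq n + 1) ^ 8 := by ring
  exact_mod_cast h5

/-- The slack strategy with its dimension as a plain natural number `m₀ ≤ 2(dq n + 1)⁸` (no `Fintype.card` in the types downstream). -/
theorem exists_slackStrategy' (n : ℕ) : ∃ m₀ : ℕ, (m₀ : ℝ) ≤ 2 * ((dq n : ℝ) + 1) ^ 8 ∧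
    ∃ (P : OddSet n → Matrix (Fin m₀) (Fin m₀) ℝ) (Q : PMatch n → Matrix (Fin m₀) (Fin m₀) ℝ),
      IsPsdRect P Q ∧ (∀ U, P U ≠ 0) ∧ ∀ M, Q M ≠ 0 :=
  ⟨_, card_option_sym2_le n, exists_slackStrategy n⟩

/-- **All thresholds at once.** For `a > 0` there is `n₂` such that for `n ≥ n₂`, with `D = dq n` and `m₀ = |Option (Sym2 (Fin n))|`:
`m₀ ≤ exp(aD/4)`, `2 ≤ exp(aD/4)`, `4 ≤ exp(aD/2)` and `2·m₀²·n ≤ exp(aD)/2`. -/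
theorem exists_thresholds {a : ℝ} (ha : 0 < a) : ∃ n₂ : ℕ, ∀ n : ℕ, n₂ ≤ n →
    2 * ((dq n : ℝ) + 1) ^ 8 ≤ Real.exp (a / 4 * dq n) ∧ (2 : ℝ) ≤ Real.exp (a / 4 * dq n) ∧
    (4 : ℝ) ≤ Real.exp (a / 2 * dq n) ∧ 2 * (2 * ((dq n : ℝ) + 1) ^ 8) ^ 2 * n ≤ Real.exp (a * dq n) / 2 := by
  obtain ⟨D₁, hD₁⟩ := exists_mul_pow_le_exp (show 0 < a / 4 by positivity) (show (0 : ℝ) < 2 by norm_num) 8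
  obtain ⟨D₂, hD₂⟩ := exists_mul_pow_le_exp (show 0 < a / 4 by positivity) (show (0 : ℝ) < 2 by norm_num) 0
  obtain ⟨D₃, hD₃⟩ := exists_mul_pow_le_exp (show 0 < a / 2 by positivity) (show (0 : ℝ) < 4 by norm_num) 0
  obtain ⟨D₄, hD₄⟩ := exists_mul_pow_le_exp ha (show (0 : ℝ) < 16 by norm_num) 20
  refine ⟨(max D₁ (max D₂ (max D₃ D₄))) ^ 4, fun n hn => ?_⟩
  have hD : max D₁ (max D₂ (max D₃ D₄)) ≤ dq n := le_dq_of_pow_le hn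
  simp only [max_le_iff] at hD
  obtain ⟨hD1, hD2, hD3, hD4⟩ := hD
  have hn4 : (n : ℝ) ≤ ((dq n : ℝ) + 1) ^ 4 := by linarith [natCast_succ_le_dq_succ_pow_four n]
  refine ⟨hD₁ _ hD1, by simpa using hD₂ _ hD2, by simpa using hD₃ _ hD3, ?_⟩
  have hD0 : (0 : ℝ) ≤ (dq n : ℝ) + 1 := by positivity
  calc 2 * (2 * ((dq n : ℝ) + 1) ^ 8) ^ 2 * n ≤ 2 * (2 * ((dq n : ℝ) + 1) ^ 8) ^ 2 * ((dq n : ℝ) + 1) ^ 4 := by gcongr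
    _ = (16 * ((dq n : ℝ) + 1) ^ 20) / 2 := by ring
    _ ≤ Real.exp (a * dq n) / 2 := by gcongr; exact hD₄ _ hD4

end Asymptotics

/-! ### §4 The reduction: the crux for nowhere-zero strategies implies the crux -/

section Reduction

variable {n : ℕ}

/-- **Padding a strategy by the scaled slack strategy.** For a tight-orthogonal psd rectangle `(X,Y)` of dimension `r`, the slack strategy `(P,Q)` of
dimension `m₀` and `0 < ε ≤ 1`: the padded pair `(X ⊕ εP, Y ⊕ Q)` (dimension `r + m₀`) is a tight-orthogonal psd rectangle with no zero operator
and value kernel `tr(X_U Y_M) + ε·tr(P_U Q_M)`. [cite: BrietDadushPokutta2014, Thm. 6 (§3)] -/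
theorem exists_padded {r m : ℕ} {X : OddSet n → Matrix (Fin r) (Fin r) ℝ} {Y : PMatch n → Matrix (Fin r) (Fin r) ℝ} (hXY : IsPsdRect X Y)
    {P : OddSet n → Matrix (Fin m) (Fin m) ℝ} {Q : PMatch n → Matrix (Fin m) (Fin m) ℝ} (hPQ : IsPsdRect P Q) (hP : ∀ U, P U ≠ 0)
    (hQ : ∀ M, Q M ≠ 0) {ε : ℝ} (hε0 : 0 < ε) (hε1 : ε ≤ 1) :
    ∃ (X' : OddSet n → Matrix (Fin (r + m)) (Fin (r + m)) ℝ) (Y' : PMatch n → Matrix (Fin (r + m)) (Fin (r + m)) ℝ),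
      IsPsdRect X' Y' ∧ (∀ U, X' U ≠ 0) ∧ (∀ M, Y' M ≠ 0) ∧
      ∀ U M, (X' U * Y' M).trace = (X U * Y M).trace + ε * (P U * Q M).trace := by
  set e : Fin (r + m) ≃ Fin r ⊕ Fin m := finSumFinEquiv.symm with he
  refine ⟨fun U => (fromBlocks (X U) 0 0 (ε • P U)).submatrix e e, fun M => (fromBlocks (Y M) 0 0 (Q M)).submatrix e e,
    isPsdRect_pad e hXY (isPsdRect_smul hPQ hε0.le hε1), fun U => ?_, fun M => ?_, fun U M => ?_⟩
  · exact submatrix_equiv_ne_zero e (fromBlocks_diag_ne_zero (smul_ne_zero hε0.ne' (hP U)))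
  · exact submatrix_equiv_ne_zero e (fromBlocks_diag_ne_zero (hQ M))
  · rw [trace_pad_mul_pad, smul_mul_assoc, trace_smul, smul_eq_mul]

/-- **NOWHERE-ZERO PADDING: THE ACTIVITY PATTERN IS FREE IN THE DIMENSION BUDGET.** If the crux `TracialDecayExp20` holds (with constant `a`) for
tight-orthogonal psd rectangles WITHOUT ZERO OPERATORS (`X_U ≠ 0` for every cut, `Y_M ≠ 0` for every matching — the 'fully active', exactly
constrained strategies of bricks 76/79), then it holds for ALL tight-orthogonal psd rectangles with constant `a/2`. Given `(X,Y)` of dimension `r`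
in the budget `r²n < exp(aD/2)`, pad it by `ε` times the slack strategy (§2, dimension `m₀ = C(n+1,2)+1`): the padded pair has dimension
`R = r + m₀ ≤ 2 exp(aD/4) ≤ exp(aD/2)` (budget `R²n < exp(aD)` for `n ≥ n₂`), no zero operator, and value `Σ W tr(X Y) + ε·s`; the hypothesis gives
`Σ W tr(XY) + ε s ≤ R·exp(−aD)` for every `ε ∈ (0,1]`, hence `Σ W tr(XY) ≤ R·exp(−aD) ≤ exp(−aD/2)` and the normalised value is `≤ exp(−aD/2)`.
The conclusion is token-for-token the body of the route decl `TracialDecayExp20` (whose module is not importable from a support file).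
[cite: Rothvoss2017, §2 (PDF pp. 5–6)] [cite: BrietDadushPokutta2014, Thm. 6 (§3)] -/
theorem tracialDecayExp20_of_nowhereZero
    (h : ∃ a : ℝ, 0 < a ∧ ∃ n₁ : ℕ, ∀ n : ℕ, n₁ ≤ n → Even n → ∀ (t : ℕ) (C : Finset ℕ) (w : ℕ → ℝ),
      IsBalancedDesign n t (Tq n) (dq n) 20 C w → ∀ r : ℕ, 0 < r → (r : ℝ) ^ 2 * n < Real.exp (a * (dq n : ℝ)) →
      ∀ (X : OddSet n → Matrix (Fin r) (Fin r) ℝ) (Y : PMatch n → Matrix (Fin r) (Fin r) ℝ), IsPsdRect X Y →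
        (∀ U, X U ≠ 0) → (∀ M, Y M ≠ 0) →
        (∑ U, ∑ M, levelWeight n t C w U M * (X U * Y M).trace) / r ≤ Real.exp (-(a * (dq n : ℝ)))) :
    ∃ a : ℝ, 0 < a ∧ ∃ n₁ : ℕ, ∀ n : ℕ, n₁ ≤ n → Even n → ∀ (t : ℕ) (C : Finset ℕ) (w : ℕ → ℝ),
      IsBalancedDesign n t (Tq n) (dq n) 20 C w → ∀ r : ℕ, 0 < r → (r : ℝ) ^ 2 * n < Real.exp (a * (dq n : ℝ)) →
        TracialValueLEAt (levelWeight n t C w) (Real.exp (-(a * (dq n : ℝ)))) r := by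
  obtain ⟨a, ha, n₁, hyp⟩ := h
  obtain ⟨n₂, hn₂⟩ := exists_thresholds ha
  refine ⟨a / 2, by positivity, max n₁ (max n₂ 1), fun n hn hev t C w hdes r hr hbud X Y hXY => ?_⟩
  have hn₁ : n₁ ≤ n := le_trans (le_max_left _ _) hn
  have hn1 : 1 ≤ n := le_trans (le_trans (le_max_right _ _) (le_max_right _ _)) hn
  obtain ⟨hm8, h2, h4, hmn8⟩ := hn₂ n (le_trans (le_trans (le_max_left _ _) (le_max_right _ _)) hn)
  obtain ⟨m₀, hm₀, P, Q, hPQ, hP, hQ⟩ := exists_slackStrategy' n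
  set D : ℝ := (dq n : ℝ) with hDdef
  set W := levelWeight n t C w with hW
  have hm : (m₀ : ℝ) ≤ Real.exp (a / 4 * D) := hm₀.trans hm8
  have hmn : 2 * (m₀ : ℝ) ^ 2 * n ≤ Real.exp (a * D) / 2 :=
    le_trans (by have : (0 : ℝ) ≤ n := by positivity
                 gcongr) hmn8
  set S := ∑ U, ∑ M, W U M * (X U * Y M).trace with hS
  set s := ∑ U, ∑ M, W U M * (P U * Q M).trace with hs
  -- exponent bookkeeping
  have hexp4 : Real.exp (a / 4 * D) * Real.exp (a / 4 * D) = Real.exp (a / 2 * D) := by rw [← Real.exp_add]; ring_nf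
  have hexp2 : Real.exp (a / 2 * D) * Real.exp (a / 2 * D) = Real.exp (a * D) := by rw [← Real.exp_add]; ring_nf
  have hbud' : (r : ℝ) ^ 2 * n < Real.exp (a / 2 * D) := by rw [hDdef]; convert hbud using 2
  -- the padded dimension `R = r + m₀` and its budget
  have hr1 : (1 : ℝ) ≤ r := by exact_mod_cast hr
  have hrD : (r : ℝ) < Real.exp (a / 4 * D) := by
    have h1 : (r : ℝ) ^ 2 < Real.exp (a / 4 * D) ^ 2 := by
      have hn1' : (1 : ℝ) ≤ n := by exact_mod_cast hn1
      rw [pow_two (Real.exp _), hexp4]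
      nlinarith [hbud', pow_nonneg (Nat.cast_nonneg r : (0 : ℝ) ≤ r) 2]
    exact lt_of_pow_lt_pow_left₀ 2 (Real.exp_pos _).le h1
  have hR : ((r : ℝ) + m₀) ≤ Real.exp (a / 2 * D) := by
    calc ((r : ℝ) + m₀) ≤ Real.exp (a / 4 * D) + Real.exp (a / 4 * D) := by linarith
      _ = 2 * Real.exp (a / 4 * D) := by ring
      _ ≤ Real.exp (a / 4 * D) * Real.exp (a / 4 * D) := by gcongr
      _ = Real.exp (a / 2 * D) := hexp4
  have hRbud : (((r + m₀ : ℕ) : ℝ)) ^ 2 * n < Real.exp (a * D) := by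
    have hm0 : (0 : ℝ) ≤ m₀ := by positivity
    have hn0 : (0 : ℝ) ≤ n := by positivity
    push_cast
    calc (((r : ℝ) + m₀)) ^ 2 * n ≤ (2 * (r : ℝ) ^ 2 + 2 * (m₀ : ℝ) ^ 2) * n := by
          gcongr; nlinarith [sq_nonneg ((r : ℝ) - m₀)]
      _ = 2 * ((r : ℝ) ^ 2 * n) + 2 * (m₀ : ℝ) ^ 2 * n := by ring
      _ < 2 * Real.exp (a / 2 * D) + Real.exp (a * D) / 2 := add_lt_add_of_lt_of_le (by linarith) hmn
      _ ≤ Real.exp (a * D) := by nlinarith [h4, Real.exp_pos (a / 2 * D), hexp2]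
  -- the key inequality, for every `ε ∈ (0,1]`
  have key : ∀ ε : ℝ, 0 < ε → ε ≤ 1 → S + ε * s ≤ ((r : ℝ) + m₀) * Real.exp (-(a * D)) := by
    intro ε hε0 hε1
    obtain ⟨X', Y', hXY', hX', hY', htr⟩ := exists_padded hXY hPQ hP hQ hε0 hε1
    have hv := hyp n hn₁ hev t C w hdes (r + m₀) (by omega) (by rw [hDdef] at hRbud; exact hRbud) X' Y' hXY' hX' hY'
    have hRpos : (0 : ℝ) < ((r + m₀ : ℕ) : ℝ) := by positivity
    rw [div_le_iff₀ hRpos] at hv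
    have heq : ∑ U, ∑ M, levelWeight n t C w U M * (X' U * Y' M).trace = S + ε * s := by
      rw [hS, hs, hW, mul_sum, ← sum_add_distrib]
      refine sum_congr rfl fun U _ => ?_
      rw [mul_sum, ← sum_add_distrib]
      exact sum_congr rfl fun M _ => by rw [htr U M]; ring
    rw [heq] at hv
    calc S + ε * s ≤ Real.exp (-(a * (dq n : ℝ))) * ((r + m₀ : ℕ) : ℝ) := hv
      _ = ((r : ℝ) + m₀) * Real.exp (-(a * D)) := by push_cast; rw [hDdef]; ring
  -- let `ε → 0`
  have hS_le : S ≤ ((r : ℝ) + m₀) * Real.exp (-(a * D)) := by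
    rcases le_or_gt 0 s with hs0 | hs0
    · have h1 := key 1 one_pos le_rfl
      linarith
    · refine le_of_forall_pos_le_add fun δ hδ => ?_
      have hns : 0 < -s := neg_pos.2 hs0
      have hε : 0 < min 1 (δ / (-s)) := lt_min one_pos (div_pos hδ hns)
      have h1 := key _ hε (min_le_left _ _)
      have h2 : min 1 (δ / (-s)) * (-s) ≤ δ := by
        calc min 1 (δ / (-s)) * (-s) ≤ δ / (-s) * (-s) := mul_le_mul_of_nonneg_right (min_le_right _ _) hns.le
          _ = δ := div_mul_cancel₀ δ hns.ne'
      rw [mul_neg] at h2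
      linarith
  -- conclude
  have hexp : ((r : ℝ) + m₀) * Real.exp (-(a * D)) ≤ Real.exp (-(a / 2 * (dq n : ℝ))) := by
    rw [← hDdef]
    have h1 : Real.exp (-(a / 2 * D)) = Real.exp (a / 2 * D) * Real.exp (-(a * D)) := by rw [← Real.exp_add]; ring_nf
    rw [h1]
    exact mul_le_mul_of_nonneg_right hR (Real.exp_pos _).le
  show S / r ≤ Real.exp (-(a / 2 * (dq n : ℝ)))
  have hpos : 0 < Real.exp (-(a / 2 * (dq n : ℝ))) := Real.exp_pos _
  rcases le_or_gt 0 S with hS0 | hS0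
  · calc S / r ≤ S := div_le_self hS0 hr1
      _ ≤ _ := hS_le.trans hexp
  · have : S / r < 0 := div_neg_of_neg_of_pos hS0 (by exact_mod_cast hr)
    linarith

end Reduction

end Summit.PneNP.PneNP.Theorems.ChebyshevTracialDesignNowhereZeroPadding
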